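import Summits.CriticalPhenomena.PercolationContinuityZ3.Theorems.PercNearOneGluingNoHeavyQuantCriterionRate
import Summits.CriticalPhenomena.PercolationContinuityZ3.Theorems.PercNearOneGluingNoHeavyQuantThetaModulusR4
import HarnessLib

/-!
# Geometric one-arm rates along a scale sequence ⇒ `OneArmRateAtCritical` ⇒ explicit modulus for `θ`
# (quant lane: the criterion-rate interface `Quant.SlabCriterion` composed with R4)

builds on p205010 (kernel theorem, internal audit signed; external expert review pending).
Status sentence for p205010: "θ(p_c) = 0 on ℤ^d, all d ≥ 2 — kernel-verified (Lean 4/Mathlib, standard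
axioms); internal adversarial audit SIGNED 2026-08-20 04:29Z; external expert review pending."

Seat `prim-quant-p4`, `--supports stmt-CriticalPhenomena-4575`; pure proofs (compositions).  MEMO-LEVEL programme (LADDER R5): the
criterion instance (`knCriterion`, S4) is NOT yet a theorem; an explicit function tending to 0 and nothing more.

The lane's criterion files conclude rates of the shape "`π_{p_c}(N) ≤ ρ^j` whenever `s j ≤ N`" for an explicit scale sequence `s`
(`Quant.SlabCriterion.oneArm_rate_criticalProbI`, `…_of_dkt`; `s = C.iterScale`, `ρ = 1 − C.η`).  Here:

* `oneArmRateAtCritical_of_pow_scaleSeq` — any such family gives `Quant.OneArmRateAtCritical d f` with the explicit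
  `f(N) = ρ^{J(N)}`, `J(N) = Nat.findGreatest (fun j => s j ≤ N) N` (`0 ≤ ρ < 1`; no monotonicity of `s` needed);
* `thetaModulusNearCritical_of_pow_scaleSeq` — composed with R4: `Quant.ThetaModulusNearCritical d ω`, `ω` explicit;
* `SlabCriterion.eta_le_one`, `thetaModulusNearCritical_of_slabCriterion`, `thetaModulusNearCritical_of_slabCriterion_dkt` — the
  `SlabCriterion` corollaries (`C.Holds` + uniqueness zones at `p_c`, resp. + DKT domination ⇒ explicit modulus), so that the
  programme's `thetaModulus_explicit` is a one-liner once `knCriterion_holds` lands.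
-/

noncomputable section

namespace Summit.CriticalPhenomena.PercolationContinuityZ3.Theorems

namespace ThetaModulus

open MeasureTheory Set Filter Topology Literature.Probability.Percolation Literature.Probability.LatticeModels
open Summit.CriticalPhenomena.PercolationContinuityZ3.Theorems.SurfaceTension
open scoped Classical

variable {d : ℕ}

/-- **Geometric rate along a scale sequence ⇒ `OneArmRateAtCritical`.**  If `π_{p_c}(N) ≤ ρ^j` whenever `s j ≤ N` (`0 ≤ ρ < 1`, any
`s : ℕ → ℕ`), then `Quant.OneArmRateAtCritical d (N ↦ ρ^{J(N)})` with `J(N) = Nat.findGreatest (fun j => s j ≤ N) N` (`J(N) → ∞`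
since `J(N) ≥ j` as soon as `N ≥ max (s j) j`).  New (bookkeeping). -/
theorem oneArmRateAtCritical_of_pow_scaleSeq {s : ℕ → ℕ} {ρ : ℝ} (hρ0 : 0 ≤ ρ) (hρ1 : ρ < 1)
    (hrate : ∀ j N : ℕ, s j ≤ N → oneArmProb d (criticalProbI d) N ≤ ρ ^ j) :
    Quant.OneArmRateAtCritical d (fun N => ρ ^ Nat.findGreatest (fun j => s j ≤ N) N) := by
  refine ⟨?_, fun N _ => ?_⟩
  · -- `J(N) → ∞`, hence `ρ^{J(N)} → 0`
    have hJ : Tendsto (fun N => Nat.findGreatest (fun j => s j ≤ N) N) atTop atTop := by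
      refine tendsto_atTop_atTop.2 fun j => ⟨max (s j) j, fun N hN => ?_⟩
      exact Nat.le_findGreatest (le_of_max_le_right hN) (le_of_max_le_left hN)
    exact (tendsto_pow_atTop_nhds_zero_of_lt_one hρ0 hρ1).comp hJ
  · -- the bound at `N`
    show oneArmProb d (criticalProbI d) N ≤ ρ ^ Nat.findGreatest (fun j => s j ≤ N) N
    by_cases hJ0 : Nat.findGreatest (fun j => s j ≤ N) N = 0
    · rw [hJ0, pow_zero]
      unfold oneArmProb; exact measureReal_le_one
    · exact hrate _ N (Nat.findGreatest_of_ne_zero (m := Nat.findGreatest (fun j => s j ≤ N) N) rfl hJ0)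

/-- **Geometric rate along a scale sequence ⇒ explicit modulus** (composition with R4
`thetaModulusNearCritical_of_oneArmRate`): for `d ≥ 2`, `Quant.ThetaModulusNearCritical d ω` with
`ω(t) = inf_n (√(ρ^{J(n+1)}) + t·√(#E(Λ_{n+1})/(2p_c(1−p_c))))²` for `t ≤ (1−p_c)/2` and `1` beyond.  New (composition). -/
theorem thetaModulusNearCritical_of_pow_scaleSeq (hd : 2 ≤ d) {s : ℕ → ℕ} {ρ : ℝ} (hρ0 : 0 ≤ ρ) (hρ1 : ρ < 1)
    (hrate : ∀ j N : ℕ, s j ≤ N → oneArmProb d (criticalProbI d) N ≤ ρ ^ j) :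
    Quant.ThetaModulusNearCritical d (fun t =>
      if t ≤ (1 - (criticalProbI d : ℝ)) / 2 then
        ⨅ n : ℕ, (Real.sqrt (ρ ^ Nat.findGreatest (fun j => s j ≤ n + 1) (n + 1)) +
          t * Real.sqrt ((((box d (n + 1)).sym2.filter (· ∈ (zdGraph d).edgeSet)).card : ℝ) /
            (2 * (criticalProbI d : ℝ) * (1 - criticalProbI d)))) ^ 2
      else 1) := by
  have hmain := thetaModulusNearCritical_of_oneArmRate hd (oneArmRateAtCritical_of_pow_scaleSeq hρ0 hρ1 hrate)
  simpa only using hmain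

variable [NeZero d]

/-- The defect of a criterion that holds with its uniqueness zones at `p_c` is at most `1` (a probability is `≥ 0`).
MEMO-LEVEL programme. -/
theorem SlabCriterion.eta_le_one (hd : 2 ≤ d) (C : Quant.SlabCriterion d) (hC : C.Holds) (hU : C.UniqAt (criticalProbI d)) :
    C.η ≤ 1 := by
  have h := C.scaleDefect_criticalProbI hd hC hU le_rfl
  linarith [(measureReal_nonneg :
    0 ≤ (bondPercolation (zdGraph d) (criticalProbI d)).real (boxCrossing d C.m₀ (C.lHi C.m₀)))]

/-- **Criterion ⇒ explicit modulus.**  If a `Quant.SlabCriterion d` holds and its uniqueness zones hold at `p_c` (`d ≥ 2`), then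
`Quant.ThetaModulusNearCritical d ω_C` with the explicit
`ω_C(t) = inf_n (√((1−η)^{J(n+1)}) + t·√(#E(Λ_{n+1})/(2p_c(1−p_c))))²`, `J(N) = Nat.findGreatest (fun j => C.iterScale j ≤ N) N`,
for `t ≤ (1−p_c)/2` (`1` beyond).  (`Quant.SlabCriterion.oneArm_rate_criticalProbI` ∘ `thetaModulusNearCritical_of_pow_scaleSeq`.)
MEMO-LEVEL programme: the instance `knCriterion` is the open obligation.
builds on p205010 (kernel theorem, internal audit signed; external expert review pending). -/
theorem thetaModulusNearCritical_of_slabCriterion (hd : 2 ≤ d) (C : Quant.SlabCriterion d) (hC : C.Holds)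
    (hU : C.UniqAt (criticalProbI d)) :
    Quant.ThetaModulusNearCritical d (fun t =>
      if t ≤ (1 - (criticalProbI d : ℝ)) / 2 then
        ⨅ n : ℕ, (Real.sqrt ((1 - C.η) ^ Nat.findGreatest (fun j => C.iterScale j ≤ n + 1) (n + 1)) +
          t * Real.sqrt ((((box d (n + 1)).sym2.filter (· ∈ (zdGraph d).edgeSet)).card : ℝ) /
            (2 * (criticalProbI d : ℝ) * (1 - criticalProbI d)))) ^ 2
      else 1) :=
  thetaModulusNearCritical_of_pow_scaleSeq hd (s := C.iterScale) (by linarith [SlabCriterion.eta_le_one hd C hC hU])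
    (by linarith [C.η_pos]) (fun _ _ hN => C.oneArm_rate_criticalProbI hd hC hU hN)

/-- **Criterion + DKT domination ⇒ explicit modulus** (the end-to-end shape of `Quant.SlabCriterion.oneArm_rate_criticalProbI_of_dkt`,
composed with R4).  MEMO-LEVEL programme: the instance `knCriterion` is the open obligation.
builds on p205010 (kernel theorem, internal audit signed; external expert review pending). -/
theorem thetaModulusNearCritical_of_slabCriterion_dkt (hd : 2 ≤ d) (C : Quant.SlabCriterion d) (hC : C.Holds)
    {α : ℝ} {n₁ : ℕ}
    (hdkt : ∀ n : ℕ, n₁ ≤ n → ∀ k : ℕ, k ≤ ⌊(n : ℝ) ^ α⌋₊ →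
      (bondPercolation (zdGraph d) (criticalProbI d)).real (uniqZone (d := d) k n)ᶜ ≤ (n : ℝ) ^ (-α))
    (hM : ∀ m, C.m₀ ≤ m → ∀ u, u < C.nU → n₁ ≤ C.M u m)
    (hc : ∀ m, C.m₀ ≤ m → ∀ u, u < C.nU → C.c u m ≤ ⌊(C.M u m : ℝ) ^ α⌋₊)
    (hτ : ∀ m, C.m₀ ≤ m → ∀ u, u < C.nU → (C.M u m : ℝ) ^ (-α) ≤ C.τ) :
    Quant.ThetaModulusNearCritical d (fun t =>
      if t ≤ (1 - (criticalProbI d : ℝ)) / 2 then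
        ⨅ n : ℕ, (Real.sqrt ((1 - C.η) ^ Nat.findGreatest (fun j => C.iterScale j ≤ n + 1) (n + 1)) +
          t * Real.sqrt ((((box d (n + 1)).sym2.filter (· ∈ (zdGraph d).edgeSet)).card : ℝ) /
            (2 * (criticalProbI d : ℝ) * (1 - criticalProbI d)))) ^ 2
      else 1) :=
  thetaModulusNearCritical_of_slabCriterion hd C hC (C.uniqAt_criticalProbI_of_dkt hdkt hM hc hτ)

end ThetaModulus

end Summit.CriticalPhenomena.PercolationContinuityZ3.Theorems
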